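import Literature.NumberTheory.Automorphic.GLnLeviOrbitalDescentCanonicalBochner
import Literature.NumberTheory.Automorphic.GLnLeviOrbitalDescentCanonicalOne
import HarnessLib

/-!
# Parabolic descent on `GL_n(F)`, Bochner form, with the Iwasawa constant EXPLICIT: under `ν∕ν_M = C • π_*(κ ⊗ μ_U)` the descent identity
# `∫_{G⧸T} φ(y p y⁻¹) d(ν∕t) = (C ‖det(1−K_p)‖⁻¹ ‖det K_p‖).toReal • ∫_{M⧸T} ∫_{K×U_c} φ(k ((m p m⁻¹) u) k⁻¹) d(κ⊗μ_U) d(ν_M∕t′)` holds with THAT `C`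

Topic `NumberTheory/Automorphic`; namespace `Literature.NumberTheory.Automorphic`.  KERNEL mathematics only: theorems, no definition, no named fact, no
instance, no `sorry`.  Cell `pub/hodgecm-mathlib`, programme P3a ∕ line «CMCharIdentityTest» stub (a) `stub_splitTransferIsTransfer` (F0P3b desk, ED. 5):
the split-place transfer `τ_v · f̄^P` is now a NAMED function (★ `UnitaryGroup.cmSplitTransfer`, constant `νG(K′)∕νH(K_H)` explicit), so the descent
chain of [Rogawski1990, Lemma 4.13.1 (a)] must be run with its constant THREADED, not sealed in an `∃`.  ★ B2
`GLnLeviOrbitalDescentCanonicalBochner.exists_integral_descConj_quotientMeasure_eq_smul_integral_levi` gives `∃ C ∈ (0, ∞)`; ★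
`GLnLeviOrbitalDescentCanonicalOne.lintegral_descConj_quotientMeasure_eq_mul_lintegral_levi_of_eq_smul_map` identifies it at the `lintegral` level
as the Iwasawa constant `C` of the canonical quotient measure, `ν∕ν_M = C • π_*(κ ⊗ μ_U)` (★ `exists_quotientMeasure_levi_eq_smul_map`, pinned by ★
`coe_mul_measure_eq_of_quotientMeasure_eq_smul_map`: `C · κ(K) · μ_U(U∩K) · ν_M(M∩K) = ν(K)`).  This file is the Bochner reading WITH THAT `C`:
* **`integral_descConj_quotientMeasure_eq_smul_integral_levi_of_eq_smul_map`** — ★ B2's statement with `∃ C` replaced by the hypothesis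
  `hq : quotientMeasure M ν_M _ ν = C • π_*(κ ⊗ μ_U)`; proof = ★ B2's passage «`lintegral` identity ⇒ measure identity ⇒ Bochner identity» (★
  `map_descConj_eq_smul_map_levi_of_forall_lintegral`, ★ `integral_descConj_eq_smul_integral_levi_of_map_eq`) fed by ★ CanonicalOne §1.
HONEST LABEL: HC_CM is proved only modulo the printed citations (2 remaining named inputs hLiu418, h413) until rung 0 closes; this file is `GL_n`
measure theory and discharges none of them.

## References
* [Rogawski1990] J. D. Rogawski, *Automorphic Representations of Unitary Groups in Three Variables*, Ann. of Math. Stud. 123 (1990), §4.13 Lemma 4.13.1 (a)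
  pp. 64–66; §4.3 (4.3.1) p. 43; §4.4 p. 44.
* [DeitmarEchterhoff2014] A. Deitmar, S. Echterhoff, *Principles of Harmonic Analysis*, 2nd ed. (2014), Thm. 1.5.3.
* [Folland1995] G. B. Folland, *A Course in Abstract Harmonic Analysis* (1995), §2.6 Thm. 2.49.
-/

set_option autoImplicit false

noncomputable section

open scoped MatrixGroups NNReal ENNReal
open MeasureTheory Measure Matrix Topology

namespace Literature.NumberTheory.Automorphic

open Literature.MeasureTheory.Group
open Literature.NumberTheory.GaloisRepresentations.IsNonarchimedeanLocalField

variable (F : Type*) [Field F] [ValuativeRel F] [TopologicalSpace F] [IsNonarchimedeanLocalField F]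
  [MeasurableSpace F] [BorelSpace F]
  {n : ℕ} {c : Fin n → Bool} [MeasurableSpace (GL (Fin n) F)] [BorelSpace (GL (Fin n) F)]

/-- **PARABOLIC DESCENT OF ORBITAL INTEGRALS, BOCHNER FORM, WITH THE IWASAWA CONSTANT EXPLICIT** [Rogawski1990, Lemma 4.13.1 (a):
`Φ^G(γ, f) = |D_{G∕M}(γ)|^{−1∕2} Φ^M(γ, f̄^P)` with the compatible measures of §4.3 and the normalisations of §4.4]: let `c` be monotone, `M = M_c`,
`ν`, `ν_M` Haar measures on `GL_n(F)` and `M`, `κ`, `μ_U` Haar measures on `K = GL_n(𝒪)` and `U_c`, and suppose the canonical quotient measure is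
`ν∕ν_M = C • π_*(κ ⊗ μ_U)`, `π(k, u) = k u M`.  Then for EVERY closed `T ≤ M`, every Haar inversion-invariant `t` on `T` (`t′` its transport to `T ⊓ M`),
every `p ∈ P_c ∩ M` centralised by `T` with `det(1 − K_p) ≠ 0` and every CONTINUOUS `φ : GL_n(F) → E` with `y ↦ φ(y p y⁻¹)` integrable for `ν∕t`:
the `M ⧸ T`-side integrand is `ν_M∕t′`-integrable and
`∫_{G⧸T} φ(y p y⁻¹) d(ν∕t) = (C ‖det(1−K_p)‖⁻¹ ‖det K_p‖).toReal • ∫_{M⧸T} ∫_{K×U_c} φ(k ((m p m⁻¹) u) k⁻¹) d(κ⊗μ_U) d(ν_M∕t′)` — with THE SAME `C`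
(★ B2 `exists_integral_descConj_quotientMeasure_eq_smul_integral_levi` with its constant identified).
[cite: Rogawski1990, §4.13 Lemma 4.13.1 (a) pp. 64–66; §4.3 (4.3.1) p. 43] [cite: DeitmarEchterhoff2014, Thm. 1.5.3] [cite: Folland1995, §2.6 Thm. 2.49] -/
theorem integral_descConj_quotientMeasure_eq_smul_integral_levi_of_eq_smul_map
    [T2Space (GL (Fin n) F)] [SecondCountableTopology (GL (Fin n) F)] [LocallyCompactSpace (GL (Fin n) F)]
    {M : Subgroup (GL (Fin n) F)} (hM : M = standardLeviGL F c) (hMc : IsClosed (M : Set (GL (Fin n) F)))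
    [LocallyCompactSpace ↥M] [MeasurableSpace (GL (Fin n) F ⧸ M)] [BorelSpace (GL (Fin n) F ⧸ M)]
    (ν : Measure (GL (Fin n) F)) [IsHaarMeasure ν] [ν.IsMulRightInvariant]
    (νM : Measure ↥M) [IsHaarMeasure νM] [νM.IsMulRightInvariant] [νM.IsInvInvariant]
    (κ : Measure ↥(glInt n F)) [IsHaarMeasure κ]
    (μN : Measure ↥(unipotentRadicalGL F c)) [IsHaarMeasure μN] [SFinite μN] {C : ℝ≥0}
    (hq : quotientMeasure M νM hMc ν = C • Measure.map
      (fun q : ↥(glInt n F) × ↥(unipotentRadicalGL F c) =>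
        (QuotientGroup.mk ((q.1 : GL (Fin n) F) * (q.2 : GL (Fin n) F)) : GL (Fin n) F ⧸ M)) (κ.prod μN))
    (T : Subgroup (GL (Fin n) F)) (hT : IsClosed (T : Set (GL (Fin n) F))) (hTM : T ≤ M)
    [MeasurableSpace (GL (Fin n) F ⧸ T)] [BorelSpace (GL (Fin n) F ⧸ T)]
    [MeasurableSpace (↥M ⧸ T.subgroupOf M)] [BorelSpace (↥M ⧸ T.subgroupOf M)]
    (t : Measure ↥T) [IsHaarMeasure t] [t.IsInvInvariant]
    (t' : Measure ↥(T.subgroupOf M)) [IsHaarMeasure t'] [t'.IsInvInvariant] [SFinite t']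
    (ht' : t' = Measure.map (Subgroup.subgroupOfEquivOfLe hTM).symm t)
    (p : standardParabolicGL F c) (hpM : (p : GL (Fin n) F) ∈ M)
    (hpT : ∀ s ∈ T, s * (p : GL (Fin n) F) = (p : GL (Fin n) F) * s)
    (hp : (1 - Matrix.of fun q q' : {i : Fin n // c i = false} × {j : Fin n // c j = true} =>
        ((p : GL (Fin n) F) : Matrix (Fin n) (Fin n) F) q.1 q'.1 *
          (((p⁻¹ : standardParabolicGL F c) : GL (Fin n) F) : Matrix (Fin n) (Fin n) F) q'.2 q.2).det
        ≠ 0)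
    {E : Type*} [NormedAddCommGroup E] [NormedSpace ℝ E] [CompleteSpace E]
    (φ : GL (Fin n) F → E) (hφc : Continuous φ)
    (hφi : Integrable (descConj (p : GL (Fin n) F) T hpT φ) (quotientMeasure T t hT ν)) :
    Integrable (descConj (⟨(p : GL (Fin n) F), hpM⟩ : ↥M) (T.subgroupOf M) (fun s hs => Subtype.ext (hpT (s : GL (Fin n) F) hs))
        (fun m : ↥M => ∫ q : ↥(glInt n F) × ↥(unipotentRadicalGL F c),
          φ ((q.1 : GL (Fin n) F) * ((m : GL (Fin n) F) * (q.2 : GL (Fin n) F)) * (q.1 : GL (Fin n) F)⁻¹) ∂(κ.prod μN)))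
        (quotientMeasure (T.subgroupOf M) t' (isClosed_subgroupOf T M hT) νM) ∧
    ∫ y, descConj (p : GL (Fin n) F) T hpT φ y ∂(quotientMeasure T t hT ν) =
      ((C : ℝ≥0∞) * ((normAbs F ((1 - Matrix.of
            fun q q' : {i : Fin n // c i = false} × {j : Fin n // c j = true} =>
              ((p : GL (Fin n) F) : Matrix (Fin n) (Fin n) F) q.1 q'.1 *
                (((p⁻¹ : standardParabolicGL F c) : GL (Fin n) F) : Matrix (Fin n) (Fin n) F)
                  q'.2 q.2).det)⁻¹ *
          normAbs F (Matrix.of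
            fun q q' : {i : Fin n // c i = false} × {j : Fin n // c j = true} =>
              ((p : GL (Fin n) F) : Matrix (Fin n) (Fin n) F) q.1 q'.1 *
                (((p⁻¹ : standardParabolicGL F c) : GL (Fin n) F) : Matrix (Fin n) (Fin n) F)
                  q'.2 q.2).det : ℝ≥0) : ℝ≥0∞)).toReal •
      ∫ z, descConj (⟨(p : GL (Fin n) F), hpM⟩ : ↥M) (T.subgroupOf M) (fun s hs => Subtype.ext (hpT (s : GL (Fin n) F) hs))
        (fun m : ↥M => ∫ q : ↥(glInt n F) × ↥(unipotentRadicalGL F c),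
          φ ((q.1 : GL (Fin n) F) * ((m : GL (Fin n) F) * (q.2 : GL (Fin n) F)) * (q.1 : GL (Fin n) F)⁻¹) ∂(κ.prod μN)) z
        ∂(quotientMeasure (T.subgroupOf M) t' (isClosed_subgroupOf T M hT) νM) := by
  haveI : T2Space F := (isLocalField F).toT2Space
  haveI : CompactSpace ↥(glInt n F) := isCompact_iff_compactSpace.1 (isCompact_glInt n F)
  haveI : BorelSpace ↥(glInt n F) := Subtype.borelSpace _
  haveI : IsFiniteMeasure κ := CompactSpace.isFiniteMeasure
  haveI : IsClosed (M : Set (GL (Fin n) F)) := hMc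
  haveI : SFinite (quotientMeasure (T.subgroupOf M) t' (isClosed_subgroupOf T M hT) νM) := inferInstance
  -- `C ≠ 0`: the canonical quotient measure is non-zero
  have hC0 : (C : ℝ≥0∞) ≠ 0 := by
    intro h0
    apply quotientMeasure_ne_zero M νM hMc ν
    rw [hq, ENNReal.coe_eq_zero.1 h0, zero_smul]
  -- the full constant `w = C ‖det(1−K_p)‖⁻¹ ‖det K_p‖`
  have hw0 : (C : ℝ≥0∞) * ((normAbs F ((1 - Matrix.of
              fun q q' : {i : Fin n // c i = false} × {j : Fin n // c j = true} =>
                ((p : GL (Fin n) F) : Matrix (Fin n) (Fin n) F) q.1 q'.1 *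
                  (((p⁻¹ : standardParabolicGL F c) : GL (Fin n) F) : Matrix (Fin n) (Fin n) F)
                    q'.2 q.2).det)⁻¹ *
            normAbs F (Matrix.of
              fun q q' : {i : Fin n // c i = false} × {j : Fin n // c j = true} =>
                ((p : GL (Fin n) F) : Matrix (Fin n) (Fin n) F) q.1 q'.1 *
                  (((p⁻¹ : standardParabolicGL F c) : GL (Fin n) F) : Matrix (Fin n) (Fin n) F)
                    q'.2 q.2).det : ℝ≥0) : ℝ≥0∞) ≠ 0 := by
    refine mul_ne_zero hC0 (ENNReal.coe_ne_zero.2 (mul_ne_zero ?_ ?_))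
    · rw [ne_eq, map_eq_zero]; exact inv_ne_zero hp
    · rw [ne_eq, map_eq_zero]
      exact left_ne_zero_of_mul_eq_one (det_boxAd_mul_det_boxAd_inv p)
  refine integral_descConj_eq_smul_integral_levi_of_map_eq F (quotientMeasure T t hT ν)
    (quotientMeasure (T.subgroupOf M) t' (isClosed_subgroupOf T M hT) νM) κ μN hw0 (ENNReal.mul_ne_top ENNReal.coe_ne_top ENNReal.coe_ne_top)
    p hpM hpT ?_ φ hφc hφi
  refine map_descConj_eq_smul_map_levi_of_forall_lintegral F (quotientMeasure T t hT ν)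
    (quotientMeasure (T.subgroupOf M) t' (isClosed_subgroupOf T M hT) νM) κ μN _ p hpM hpT fun Fn hFn => ?_
  rw [lintegral_descConj_quotientMeasure_eq_mul_lintegral_levi_of_eq_smul_map F hM hMc ν νM κ μN hq T hT hTM t t' ht' p hpM hpT hp hFn,
    mul_assoc]

end Literature.NumberTheory.Automorphic

end
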